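import Literature.Computability.Cryptography.HallgrenKappaEval
import Literature.Computability.Cryptography.HallgrenWalkOps
import Literature.Computability.Cryptography.PeriodFindingUniform
import HarnessLib

/-!
# Fixed-point evaluation of the distance correction of Hallgren's giant step, II: the programs

Topic `Computability/Cryptography`; continues `HallgrenKappaEval.lean` (the integer evaluator
`kappaI` of the correction `κ`, accurate to `(4F + 7)/2ᵖ`) with its `CodeFP` programs, in the
conventions of `HallgrenWalkOps.lean` (instance code `dE = (bin D, 1ᵖ)`, labels `qE`), and the
content `d` of the composition as an integer program (`compScalarI`, through the Bézout vector
`ClFP.wOf ∘ pvecs ∘ params` of `HallgrenClassGroupComposeFP.lean`). Jozsa 2003, §9 Thm. 5 / §7.1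
Prop. 35: the giant step and its distance are computed in time poly(log D, n).
Theorem-and-definition file, no named facts.

* `codeFP_lnValI`, `codeFP_lnAbsLinI`, `codeFP_lnFactorI`, `codeFP_lnMultI` (a mapped
  range summed by `intSum`);
* `compScalarI`, `compScalarI_pr` (`= compScalar`), `codeFP_compScalarI`;
* **`kappaG d a b = kappaI D p (size D + 5) (compScalarI D a b) a b`**, **`codeFP_kappaG`**, and
  **`abs_kappaQ_sub_kappaG_le`** (accuracy `(4 size D + 27)/2ᵖ` on cycle elements).

## References

* R. Jozsa, arXiv:quant-ph/0302134 (2003), §7.1 Prop. 35, §9 Thm. 5. [Jozsa2003]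
* S. Arora, B. Barak, *Computational Complexity*, CUP 2009, §1.3. [AroraBarak2009]
-/

noncomputable section

open scoped Classical

namespace Literature.Computability.Cryptography

namespace HallgrenGiantStep

open Literature.NumberTheory.QuadraticFields Literature.NumberTheory.QuadraticFields.QuadIrr HallgrenComposition
  InfraPrimitives Literature.Computability.Complexity Literature.Computability.Complexity.CodeFP
  Literature.Computability.Complexity.LogFP Hallgren2005 Hallgren2005.ClFP Hallgren2005.FormComposition
  Hallgren2005.Composition

variable {D : ℕ}

/-! ### The logarithm programs -/

/-- **`lnValI` on codes**: context `((D, 1ᵖ), (P, Q))`. [cite: Jozsa2003, §9 Thm. 5] -/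
theorem codeFP_lnValI : CodeFP (pairE dE qE) intE (fun c => lnValI c.1.1 c.1.2 c.2) := by
  have hD : CodeFP (pairE dE qE) natE (fun c => c.1.1) := (fst _ _).fst'
  have hp : CodeFP (pairE dE qE) unE (fun c => c.1.2) := (fst _ _).snd'
  have hP : CodeFP (pairE dE qE) intE (fun c => c.2.1) := (snd _ _).fst'
  have hQ : CodeFP (pairE dE qE) intE (fun c => c.2.2) := (snd _ _).snd'
  exact ((codeFP_lnQuadDyadic.comp ((intToNat.comp hP).pair ((intToNat.comp hQ).pair (hD.pair (hp.pair hp))))).congr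
    fun c => rfl)

/-- **`lnAbsLinI` on codes**: context `((D, 1ᵖ), P)`. [cite: Jozsa2003, §9 Thm. 5] -/
theorem codeFP_lnAbsLinI : CodeFP (pairE dE intE) intE (fun c => lnAbsLinI c.1.1 c.1.2 c.2) := by
  have hD : CodeFP (pairE dE intE) natE (fun c => c.1.1) := (fst _ _).fst'
  have hp : CodeFP (pairE dE intE) unE (fun c => c.1.2) := (fst _ _).snd'
  have hP : CodeFP (pairE dE intE) intE (fun c => c.2) := snd _ _
  have hpos : CodeFP (pairE dE intE) intE (fun c => lnQuadDyadic c.2.toNat 1 c.1.1 c.1.2 c.1.2) :=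
    (codeFP_lnQuadDyadic.comp ((intToNat.comp hP).pair ((const _ (1 : ℕ)).pair (hD.pair (hp.pair hp)))) :)
  have habs : CodeFP (pairE dE intE) natE (fun c => ((c.1.1 : ℤ) - c.2 ^ 2).natAbs) :=
    ((intNatAbs.comp (intSub.comp ((intOfNat.comp hD).pair (intMul.comp (hP.pair hP))))).congr fun c => by
      simp only [sq])
  have hA : CodeFP (pairE dE intE) intE (fun c => lnDyadicZ ((c.1.1 : ℤ) - c.2 ^ 2).natAbs 1 c.1.2) :=
    (codeFP_lnDyadicZ.comp (habs.pair ((const _ (1 : ℕ)).pair hp)) :)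
  have hB : CodeFP (pairE dE intE) intE (fun c => lnQuadDyadic (-c.2).toNat 1 c.1.1 c.1.2 c.1.2) :=
    (codeFP_lnQuadDyadic.comp ((intToNat.comp (intNeg.comp hP)).pair ((const _ (1 : ℕ)).pair (hD.pair (hp.pair hp)))) :)
  have hc : CodeFP (pairE dE intE) bitE (fun c => decide ((0 : ℤ) ≤ c.2)) := (intLe.comp ((const _ (0 : ℤ)).pair hP) :)
  refine ((hc.ite hpos (intSub.comp (hA.pair hB) :)).congr fun c => ?_)
  unfold lnAbsLinI
  by_cases h : (0 : ℤ) ≤ c.2 <;> simp [h]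

/-- **`lnFactorI` on codes**: context `((D, 1ᵖ), (P, Q))`. [cite: Jozsa2003, §6.2 Prop. 21, §9 Thm. 5] -/
theorem codeFP_lnFactorI : CodeFP (pairE dE qE) intE (fun c => lnFactorI c.1.1 c.1.2 c.2) := by
  have hd : CodeFP (pairE dE qE) dE (fun c => c.1) := fst _ _
  have hD : CodeFP (pairE dE qE) natE (fun c => c.1.1) := hd.fst'
  have hp : CodeFP (pairE dE qE) unE (fun c => c.1.2) := hd.snd'
  have hy : CodeFP (pairE dE qE) qE (fun c => c.2) := snd _ _
  have hP : CodeFP (pairE dE qE) intE (fun c => c.2.1) := hy.fst'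
  have hQ : CodeFP (pairE dE qE) intE (fun c => c.2.2) := hy.snd'
  have hq : CodeFP (pairE dE qE) intE (fun c => (2 * c.2.1 + c.2.2) / (2 * c.2.2)) :=
    (intEDiv.comp ((intAdd.comp ((intMul.comp ((const _ (2 : ℤ)).pair hP)).pair hQ)).pair
      (intMul.comp ((const _ (2 : ℤ)).pair hQ))) :)
  have hr : CodeFP (pairE dE qE) qE (fun c => stepWithI c.1.1 c.2 ((2 * c.2.1 + c.2.2) / (2 * c.2.2))) :=
    (codeFP_stepWithI.comp (hD.pair (hy.pair hq)) :)
  have hA : CodeFP (pairE dE qE) intE (fun c => lnAbsLinI c.1.1 c.1.2 (stepWithI c.1.1 c.2 ((2 * c.2.1 + c.2.2) / (2 * c.2.2))).1) :=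
    (codeFP_lnAbsLinI.comp (hd.pair hr.fst') :)
  have hB : CodeFP (pairE dE qE) intE (fun c =>
      lnDyadicZ (stepWithI c.1.1 c.2 ((2 * c.2.1 + c.2.2) / (2 * c.2.2))).2.natAbs 1 c.1.2) :=
    (codeFP_lnDyadicZ.comp ((intNatAbs.comp hr.snd').pair ((const _ (1 : ℕ)).pair hp)) :)
  have hc : CodeFP (pairE dE qE) bitE (fun c => decide (c.2.2 ^ 2 < (c.1.1 : ℤ))) :=
    ((intLt.comp ((intMul.comp (hQ.pair hQ)).pair (intOfNat.comp hD))).congr fun c => by simp only [sq])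
  refine ((hc.ite (const _ (0 : ℤ)) (intSub.comp (hA.pair hB) :)).congr fun c => ?_)
  unfold lnFactorI
  by_cases h : c.2.2 ^ 2 < (c.1.1 : ℤ) <;> simp [h]

/-- **`lnMultI` on codes**: context `((D, 1ᵖ), (c, 1^F))` — the factor logarithms over the
guarded Gauss iterates (`codeFP_gIter`), summed by `intSum`. [cite: Jozsa2003, §9 Thm. 5] -/
theorem codeFP_lnMultI : CodeFP (pairE dE (pairE qE unE)) intE (fun c => lnMultI c.1.1 c.1.2 c.2.1 c.2.2) := by
  have hF : CodeFP (pairE dE (pairE qE unE)) unE (fun c => c.2.2) := (snd _ _).snd'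
  -- the `k`-th term in context `(ctx, k)`; the index in unary, capped by the fuel
  have hk : CodeFP (pairE (pairE dE (pairE qE unE)) natE) unE (fun t => min t.2 t.1.2.2) :=
    (unOfNatMin.comp (((fst _ _).snd'.snd').pair (snd _ _)) :)
  have hit : CodeFP (pairE (pairE dE (pairE qE unE)) natE) qE (fun t => (gStepI t.1.1.1)^[min t.2 t.1.2.2] t.1.2.1) :=
    (codeFP_gIter.comp (((fst _ _).fst'.fst').pair (((fst _ _).snd'.fst').pair hk)) :)
  have hterm : CodeFP (pairE (pairE dE (pairE qE unE)) natE) intE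
      (fun t => lnFactorI t.1.1.1 t.1.1.2 ((gStepI t.1.1.1)^[min t.2 t.1.2.2] t.1.2.1)) :=
    (codeFP_lnFactorI.comp (((fst _ _).fst').pair hit) :)
  have hmap := (PeriodFinding.mapRange hF hterm :)
  refine ((intSum.comp hmap).congr fun c => ?_)
  show ((List.range c.2.2).map fun i => lnFactorI c.1.1 c.1.2 ((gStepI c.1.1)^[min i c.2.2] c.2.1)).sum =
    lnMultI c.1.1 c.1.2 c.2.1 c.2.2
  unfold lnMultI
  congr 1
  refine List.map_congr_left fun i hi => ?_
  rw [List.mem_range] at hi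
  rw [min_eq_left hi.le]

/-! ### The content of the composition -/

/-- **The content `d` of the composition on integer pairs**, through the Bézout vector of the four
product vectors. [cite: Jozsa2003, §7.1 Prop. 34] -/
def compScalarI (D : ℕ) (p q : ℤ × ℤ) : ℤ := (wOf (pvecs (params ((D : ℤ), formOf D p, formOf D q)))).2

/-- `compScalarI = compScalar` on pairs of quotients. [cite: Jozsa2003, §7.1 Prop. 34] -/
theorem compScalarI_pr (x y : QuadIrr D) : compScalarI D (pr x) (pr y) = compScalar x y := by
  unfold compScalarI compScalar compD
  rw [gcdVec_prodVecs]
  rfl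

/-- **The content is computable.** [cite: Jozsa2003, §7.1 Prop. 34] -/
theorem codeFP_compScalarI : CodeFP (pairE natE (pairE qE qE)) intE (fun c => compScalarI c.1 c.2.1 c.2.2) := by
  have hform : CodeFP cE formE (fun c => formOf c.1 c.2) := by
    have hD : CodeFP cE intE (fun c => (c.1 : ℤ)) := (intOfNat.comp (fst _ _) :)
    have hP : CodeFP cE intE (fun c => c.2.1) := (snd _ _).fst'
    have hQ : CodeFP cE intE (fun c => c.2.2) := (snd _ _).snd'
    have ha : CodeFP cE intE (fun c => c.2.2 / 2) := (intEDiv.comp (hQ.pair (const _ (2 : ℤ))) :)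
    have hb : CodeFP cE intE (fun c => -c.2.1) := (intNeg.comp hP :)
    have hc : CodeFP cE intE (fun c => (c.2.1 ^ 2 - (c.1 : ℤ)) / (2 * c.2.2)) :=
      ((intEDiv.comp ((intSub.comp ((intMul.comp (hP.pair hP)).pair hD)).pair
        (intMul.comp ((const _ (2 : ℤ)).pair hQ)))).congr fun c => by simp only [sq])
    exact (mkFormC.comp (ha.pair (hb.pair hc))).congr fun c => rfl
  have hD : CodeFP (pairE natE (pairE qE qE)) intE (fun c => (c.1 : ℤ)) := (intOfNat.comp (fst _ _) :)
  have hf : CodeFP (pairE natE (pairE qE qE)) formE (fun c => formOf c.1 c.2.1) :=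
    (hform.comp ((fst _ _).pair (snd _ _).fst') :)
  have hg : CodeFP (pairE natE (pairE qE qE)) formE (fun c => formOf c.1 c.2.2) :=
    (hform.comp ((fst _ _).pair (snd _ _).snd') :)
  have hpar : CodeFP (pairE natE (pairE qE qE)) parE (fun c => params ((c.1 : ℤ), formOf c.1 c.2.1, formOf c.1 c.2.2)) :=
    (paramsC.comp (hD.pair (hf.pair hg)) :)
  exact ((wOfC.comp (pvecsC.comp hpar)).snd'.congr fun c => rfl)

/-! ### The correction program -/

/-- **The correction evaluator of an instance `d = (D, p)`**: fuel `size D + 5 ≥ ⌊log₂ D⌋ + 5`, content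
from `compScalarI`. [cite: Jozsa2003, §9 Thm. 5] -/
def kappaG (d : ℕ × ℕ) (a b : ℤ × ℤ) : ℤ := kappaI d.1 d.2 (d.1.size + 5) (compScalarI d.1 a b) a b

/-- **The correction evaluator is computable**: context `((D, 1ᵖ), (a, b))`. [cite: Jozsa2003, §9 Thm. 5] [cite: AroraBarak2009, §1.3] -/
theorem codeFP_kappaG : CodeFP (pairE dE (pairE qE qE)) intE (fun c => kappaG c.1 c.2.1 c.2.2) := by
  have hd : CodeFP (pairE dE (pairE qE qE)) dE (fun c => c.1) := fst _ _
  have hD : CodeFP (pairE dE (pairE qE qE)) natE (fun c => c.1.1) := hd.fst'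
  have hp : CodeFP (pairE dE (pairE qE qE)) unE (fun c => c.1.2) := hd.snd'
  have ha : CodeFP (pairE dE (pairE qE qE)) qE (fun c => c.2.1) := (snd _ _).fst'
  have hb : CodeFP (pairE dE (pairE qE qE)) qE (fun c => c.2.2) := (snd _ _).snd'
  have hF : CodeFP (pairE dE (pairE qE qE)) unE (fun c => c.1.1.size + 5) :=
    (unAdd.comp ((codeFP_unSize.comp hD).pair (const _ (5 : ℕ) : CodeFP (pairE dE (pairE qE qE)) unE fun _ => 5)) :)
  have hc : CodeFP (pairE dE (pairE qE qE)) qE (fun c => compI c.1.1 c.2.1 c.2.2) := (codeFP_compI.comp (hD.pair (ha.pair hb)) :)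
  have hs : CodeFP (pairE dE (pairE qE qE)) qE (fun c => starI c.1.1 c.2.1 c.2.2) := (codeFP_starI.comp (hD.pair (ha.pair hb)) :)
  have hsc : CodeFP (pairE dE (pairE qE qE)) intE (fun c => compScalarI c.1.1 c.2.1 c.2.2) :=
    (codeFP_compScalarI.comp (hD.pair (ha.pair hb)) :)
  have h1 : CodeFP (pairE dE (pairE qE qE)) intE (fun c => lnMultI c.1.1 c.1.2 (compI c.1.1 c.2.1 c.2.2) (c.1.1.size + 5)) :=
    (codeFP_lnMultI.comp (hd.pair (hc.pair hF)) :)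
  have h2 : CodeFP (pairE dE (pairE qE qE)) intE (fun c =>
      lnDyadicZ (c.2.1.2 * c.2.2.2).natAbs (2 * compScalarI c.1.1 c.2.1 c.2.2 * (compI c.1.1 c.2.1 c.2.2).2).natAbs c.1.2) :=
    (codeFP_lnDyadicZ.comp ((intNatAbs.comp (intMul.comp (ha.snd'.pair hb.snd'))).pair
      ((intNatAbs.comp (intMul.comp ((intMul.comp ((const _ (2 : ℤ)).pair hsc)).pair hc.snd'))).pair hp)) :)
  have h3 : CodeFP (pairE dE (pairE qE qE)) intE (fun c => lnValI c.1.1 c.1.2 c.2.1) := (codeFP_lnValI.comp (hd.pair ha) :)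
  have h4 : CodeFP (pairE dE (pairE qE qE)) intE (fun c => lnValI c.1.1 c.1.2 c.2.2) := (codeFP_lnValI.comp (hd.pair hb) :)
  have h5 : CodeFP (pairE dE (pairE qE qE)) intE (fun c => lnValI c.1.1 c.1.2 (starI c.1.1 c.2.1 c.2.2)) :=
    (codeFP_lnValI.comp (hd.pair hs) :)
  refine ((intSub.comp ((intAdd.comp ((intAdd.comp ((intAdd.comp (h1.pair h2)).pair h3)).pair h4)).pair h5)).congr
    fun c => ?_)
  rfl

/-- **Accuracy of the correction program on cycle elements**: `|κ(a, b) − kappaG (D, p) a b/2ᵖ| ≤ (4 size D + 27)/2ᵖ`.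
[cite: Jozsa2003, §9 Thm. 5] -/
theorem abs_kappaQ_sub_kappaG_le (hD : ¬ IsSquare D) (hD4 : D % 4 = 0 ∨ D % 4 = 1) (i j p : ℕ) :
    |kappaQ (step^[i] (principalFirst D)) (step^[j] (principalFirst D)) -
        (kappaG (D, p) (pr (step^[i] (principalFirst D))) (pr (step^[j] (principalFirst D))) : ℝ) / 2 ^ p| ≤
      (4 * D.size + 27) / (2 : ℝ) ^ p := by
  unfold kappaG
  simp only
  rw [compScalarI_pr]
  have hF : Nat.log 2 D + 5 ≤ D.size + 5 := by
    have h0 : D ≠ 0 := fun h0 => hD (h0 ▸ ⟨0, rfl⟩)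
    have : Nat.log 2 D < D.size := Nat.log_lt_of_lt_pow h0 (Nat.lt_size_self D)
    omega
  have h := abs_kappaQ_sub_kappaI_le hD hD4 i j p hF
  refine h.trans_eq ?_
  push_cast; ring

end HallgrenGiantStep

end Literature.Computability.Cryptography

end
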